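import Literature.IUT.LogThetaLattice.ThetaMonoids
import Literature.IUT.LogThetaLattice.HodgeTheaterLogLink
import HarnessLib

/-!
# [IUTchIII] Prop 2.1 (i): the vertical isomorphisms of `_∞Ψ_{env}` and `D^⊩_{env}` (the two companions of `verticalΨenv`)

Mochizuki, *Inter-universal Teichmüller Theory III*, kurims manuscript (May 2020), §2, Prop 2.1 (i) p.58 l.36–40, p.59 l.1–4:
"each isomorphism of the full poly-isomorphism induced [cf. Theorem 1.5, (i)] by a vertical arrow of the Gaussian log-theta-lattice
… induces a compatible collection of isomorphisms `Ψ_{env}(^{n,m}D_>) ⥲ Ψ_{env}(^{n,m+1}D_>)`; `_∞Ψ_{env}(^{n,m}D_>) ⥲ _∞Ψ_{env}(^{n,m+1}D_>)`;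
`D^⊩_{env}(^{n,m}D^⊢_>) ⥲ D^⊩_{env}(^{n,m+1}D^⊢_>)`". [claim: Mochizuki2012, status: disputed] (D-0012 claim key). PROOF-ONLY
completion (abc-iut-L6-t3, typer of record; no definition) of `ThetaMonoids.lean` (p405523: `verticalΨenv`, `verticalDglEnv`,
`verticalΨenv_nonempty`) and `BiCoresProofs.lean` (p413492: `ThetaMonoidData.verticalΨenv_eq_map_vertical_inducedDHT`): the
`_∞Ψ_{env}` companion — which has no dedicated name, it is the term `(PolyIso.full H H').map (T.Dgt ⋙ T.ΨenvInfD)` — and the `D^⊩_{env}`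
companion are NONEMPTY and are, on the nose, the images of the Thm 1.5 (i) full poly-isomorphism of the vertical arrow (closing the
one term-level residual named in the zone owner's coverage line for IUTchIII:Prop2.1(i), 2026-08-26T06:34Z). Honest framing:
interface-level bookkeeping; no side taken on [IUTchIII] Cor 3.12; typed ≠ proved.
-/

namespace Literature.IUT.LogThetaLattice

open CategoryTheory
open Literature.IUT.HodgeTheaters

universe u

namespace ThetaMonoidData

variable {S : StripFrame.{u}} (T : ThetaMonoidData S)

/-- **IUTchIII:Prop2.1(i)** (kurims p.58) the induced poly-isomorphism `_∞Ψ_{env}(†D_>) ⥲ _∞Ψ_{env}(‡D_>)` (image of the full poly-isomorphism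
of `D`-Hodge theaters through `†HT^D ↦ †D_> ↦ _∞Ψ_{env}(†D_>)`) is nonempty. [claim: Mochizuki2012, status: disputed] -/
theorem verticalΨenvInf_nonempty (H H' : S.DHT) : ((PolyIso.full H H').map (T.Dgt ⋙ T.ΨenvInfD)).Nonempty :=
  (S.full_nonempty_DHT H H').image _

/-- **IUTchIII:Prop2.1(i)** (kurims p.59) the induced poly-isomorphism `D^⊩_{env}(†D^⊢_>) ⥲ D^⊩_{env}(‡D^⊢_>)` (`verticalDglEnv`) is nonempty.
[claim: Mochizuki2012, status: disputed] -/
theorem verticalDglEnv_nonempty (H H' : S.DHT) : (T.verticalDglEnv H H').Nonempty :=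
  (S.full_nonempty_DHT H H').image _

variable {L : LogStripData S} {Θ : ThetaLinkData S} (Λ : LogThetaLatticeDiagram L Θ)

/-- **IUTchIII:Prop2.1(i)** (kurims p.58) in a log-theta-lattice, the `_∞Ψ_{env}` transport between the `D`-Hodge theaters of `^{n,m}HT`,
`^{n,m+1}HT` IS the image of the Thm 1.5 (i) poly-isomorphism of the vertical arrow through `†HT^D ↦ †D_> ↦ _∞Ψ_{env}(†D_>)`.
[claim: Mochizuki2012, status: disputed] -/
theorem verticalΨenvInf_eq_map_vertical_inducedDHT (n m : ℤ) :
    (PolyIso.full (S.htToD.obj (Λ.HT (n, m))) (S.htToD.obj (Λ.HT (n, m + 1)))).map (T.Dgt ⋙ T.ΨenvInfD) =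
      ((Λ.vertical n m).inducedDHT).map (T.Dgt ⋙ T.ΨenvInfD) := rfl

/-- **IUTchIII:Prop2.1(i)** (kurims p.59) likewise for `D^⊩_{env}`: `verticalDglEnv` between the `D`-Hodge theaters of `^{n,m}HT`, `^{n,m+1}HT` IS the
image of the vertical arrow's Thm 1.5 (i) poly-isomorphism through `†HT^D ↦ †D_> ↦ †D^⊢_> ↦ D^⊩_{env}(†D^⊢_>)`.
[claim: Mochizuki2012, status: disputed] -/
theorem verticalDglEnv_eq_map_vertical_inducedDHT (n m : ℤ) :
    T.verticalDglEnv (S.htToD.obj (Λ.HT (n, m))) (S.htToD.obj (Λ.HT (n, m + 1))) =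
      ((Λ.vertical n m).inducedDHT).map (T.Dgt ⋙ S.DToDv ⋙ T.DglEnv) := rfl

/-- **IUTchIII:Prop2.1(i)** (kurims p.58–59) "a COMPATIBLE collection of isomorphisms": one isomorphism `ξ` of `D`-Hodge theaters (a constituent of
the vertical arrow's full poly-isomorphism) induces the three isomorphisms SIMULTANEOUSLY — the members of the three induced
poly-isomorphisms indexed by the same `ξ`. [claim: Mochizuki2012, status: disputed] -/
theorem vertical_compatible_triple (H H' : S.DHT) (ξ : H ≅ H') :
    (T.Dgt ⋙ T.ΨenvD).mapIso ξ ∈ T.verticalΨenv H H' ∧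
      (T.Dgt ⋙ T.ΨenvInfD).mapIso ξ ∈ (PolyIso.full H H').map (T.Dgt ⋙ T.ΨenvInfD) ∧
        (T.Dgt ⋙ S.DToDv ⋙ T.DglEnv).mapIso ξ ∈ T.verticalDglEnv H H' :=
  ⟨⟨ξ, PolyIso.mem_full ξ, rfl⟩, ⟨ξ, PolyIso.mem_full ξ, rfl⟩, ⟨ξ, PolyIso.mem_full ξ, rfl⟩⟩

end ThetaMonoidData

end Literature.IUT.LogThetaLattice
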